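import Summits.CriticalPhenomena.PercolationContinuityZ3.Theorems.PercNearOneGluingNoHeavyLowerTailSwitchRelaxCheck
import HarnessLib

/-!
# `NoHeavyLowerTail` (stmt-CriticalPhenomena-4575) — the FINITE RELAXATION of three-copy switching certificates, III:
# the expectation of a certificate (measure preservation) and the bridge to the four-point cells

Support file (prover prim-cert-2 gen 11; `--supports stmt-CriticalPhenomena-4575`).  No named facts, no sorries.

For a certificate `c : SwitchRelax.Cert` (part II) and the weighted triple space of a finite graph:
* `sum_wt3W_Sreal` — **`E[S] = ES c P`**, `P t = PrW D p {K | ftype τ K = t}` the type masses: the input potential contributes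
  `Σ λ₀(r,s,t) P_r P_s P_t` (box events), each program `Σ λ_p(s,t) P_s P_t` because the switchings `psi1 … psi4`
  preserve `μ ⊗ μ ⊗ μ` (`sum_wt3W_psi1 … psi4` of `…GroupThreePointLBMaps`);
* `ES_nonpos_of_check` — a passing kernel check gives `ES c P ≤ 0` (part II `Cert.sound` + nonnegative weights);
* `sum2_eq_entries`, `sum3_eq_entries` — rewriting the double/triple sums through entry lists of the potentials (the form
  in which certificate files state their tables for `ring`);
* `PrW_tyEv_eq_cell` — at `D = univ`, `τ = quad a b c y`: `P t = FourPointAtoms.cell w a b c y t` (`prodBernoulli w`).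
A certificate file then proves one polynomial identity `ES = −D·E₃` in the 15 cells and reads off `E₃ ≥ 0`.
-/

noncomputable section

namespace Summit.CriticalPhenomena.PercolationContinuityZ3.Theorems

namespace SwitchRelax

open Finset Literature.Probability.Percolation Literature.Probability.Percolation.DecisionTree
open Literature.Probability.Percolation.Gladkov ThreePointLB GroupThreePointLB FourPointAtoms
open Summit.CriticalPhenomena.PercolationContinuityZ3.Cruxes.AdditiveGluing.TieLine.ConnAtoms
open MeasureTheory Literature.Probability.LatticeModels
open scoped Classical BigOperators

section Finitary

variable {V : Type*} [Fintype V] [DecidableEq V] (τ : Fin 4 → V)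

/-! ### Type events -/

/-- The event "the configuration has type `t` at the terminals". [this work] -/
def tyEv (t : Ty) : Set (Finset (Sym2 V)) := {K | ftype τ K = t}

/-! ### Expectations of potentials -/

variable (p : Sym2 V → ℝ) (D : Finset (Sym2 V))

/-- Collapse of a triple sum supported at one point. [folklore] -/
theorem sum_ite₃ (a b c : Ty) (g : Ty → Ty → Ty → ℝ) :
    ∑ r, ∑ s, ∑ t, (if a = r then (if b = s then (if c = t then g r s t else 0) else 0) else 0) = g a b c := by
  rw [Fintype.sum_eq_single a fun r hr => by simp [Ne.symm hr]]
  rw [Fintype.sum_eq_single b fun s hs => by simp [Ne.symm hs]]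
  rw [Fintype.sum_eq_single c fun t ht => by simp [Ne.symm ht]]
  simp

/-- Collapse of a double sum supported at one point. [folklore] -/
theorem sum_ite₂ (b c : Ty) (g : Ty → Ty → ℝ) :
    ∑ s, ∑ t, (if b = s then (if c = t then g s t else 0) else 0) = g b c := by
  rw [Fintype.sum_eq_single b fun s hs => by simp [Ne.symm hs]]
  rw [Fintype.sum_eq_single c fun t ht => by simp [Ne.symm ht]]
  simp

omit [DecidableEq V] in
/-- The indicator of a box of type events, as a product of three `if`s. [this work] -/
theorem ind_box_tyEv (r s t : Ty) (x : Fin 3 → Finset (Sym2 V)) :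
    ind (box (tyEv τ r) (tyEv τ s) (tyEv τ t)) x =
      (if ftype τ (x 0) = r then 1 else 0) * (if ftype τ (x 1) = s then 1 else 0) * (if ftype τ (x 2) = t then 1 else 0) := by
  unfold ind
  simp only [ThreePointLB.mem_box, tyEv, Set.mem_setOf_eq]
  split_ifs <;> first | rfl | (exfalso; tauto) | simp_all

omit [DecidableEq V] in
/-- A function of the three types is the triple sum of its values against the box indicators. [this work] -/
theorem apply_ftype₃_eq_sum (f : Ty → Ty → Ty → ℤ) (x : Fin 3 → Finset (Sym2 V)) :
    (f (ftype τ (x 0)) (ftype τ (x 1)) (ftype τ (x 2)) : ℝ) =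
      ∑ r, ∑ s, ∑ t, (f r s t : ℝ) * ind (box (tyEv τ r) (tyEv τ s) (tyEv τ t)) x := by
  simp only [ind_box_tyEv]
  have h : ∀ r s t : Ty, (f r s t : ℝ) * ((if ftype τ (x 0) = r then (1 : ℝ) else 0) * (if ftype τ (x 1) = s then 1 else 0) *
      (if ftype τ (x 2) = t then 1 else 0)) =
      if ftype τ (x 0) = r then (if ftype τ (x 1) = s then (if ftype τ (x 2) = t then (f r s t : ℝ) else 0) else 0) else 0 := by
    intro r s t; split_ifs <;> simp
  simp only [h, sum_ite₃]

omit [DecidableEq V] in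
/-- A function of the two output types, against box indicators with first slot `univ`. [this work] -/
theorem apply_ftype₂_eq_sum (f : Ty → Ty → ℤ) (x : Fin 3 → Finset (Sym2 V)) :
    (f (ftype τ (x 1)) (ftype τ (x 2)) : ℝ) = ∑ s, ∑ t, (f s t : ℝ) * ind (box Set.univ (tyEv τ s) (tyEv τ t)) x := by
  have hb : ∀ s t, ind (box Set.univ (tyEv τ s) (tyEv τ t)) x =
      (if ftype τ (x 1) = s then (1 : ℝ) else 0) * (if ftype τ (x 2) = t then 1 else 0) := by
    intro s t
    unfold ind
    simp only [ThreePointLB.mem_box, tyEv, Set.mem_setOf_eq, Set.mem_univ, true_and]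
    split_ifs <;> first | rfl | (exfalso; tauto) | simp_all
  simp only [hb]
  have h : ∀ s t : Ty, (f s t : ℝ) * ((if ftype τ (x 1) = s then (1 : ℝ) else 0) * (if ftype τ (x 2) = t then 1 else 0)) =
      if ftype τ (x 1) = s then (if ftype τ (x 2) = t then (f s t : ℝ) else 0) else 0 := by
    intro s t; split_ifs <;> simp
  simp only [h, sum_ite₂]

/-- **`E[λ₀] = Σ λ₀(r,s,t) P_r P_s P_t`.** [this work] -/
theorem sum_wt3W_lam0 (f : Ty → Ty → Ty → ℤ) :
    ∑ x ∈ triples D, wt3W D p x * (f (ftype τ (x 0)) (ftype τ (x 1)) (ftype τ (x 2)) : ℝ) =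
      ∑ r, ∑ s, ∑ t, (f r s t : ℝ) * (PrW D p (tyEv τ r) * PrW D p (tyEv τ s) * PrW D p (tyEv τ t)) := by
  simp only [apply_ftype₃_eq_sum, Finset.mul_sum]
  rw [Finset.sum_comm]
  refine Finset.sum_congr rfl fun r _ => ?_
  rw [Finset.sum_comm]
  refine Finset.sum_congr rfl fun s _ => ?_
  rw [Finset.sum_comm]
  refine Finset.sum_congr rfl fun t _ => ?_
  rw [← sum_wt3W_ind_box p D, Finset.mul_sum]
  exact Finset.sum_congr rfl fun x _ => by ring

/-- `E[f(type Y, type Z)] = Σ f(s,t) P_s P_t`. [this work] -/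
theorem sum_wt3W_lam2 (f : Ty → Ty → ℤ) :
    ∑ x ∈ triples D, wt3W D p x * (f (ftype τ (x 1)) (ftype τ (x 2)) : ℝ) =
      ∑ s, ∑ t, (f s t : ℝ) * (PrW D p (tyEv τ s) * PrW D p (tyEv τ t)) := by
  simp only [apply_ftype₂_eq_sum, Finset.mul_sum]
  rw [Finset.sum_comm]
  refine Finset.sum_congr rfl fun s _ => ?_
  rw [Finset.sum_comm]
  refine Finset.sum_congr rfl fun t _ => ?_
  have hb := sum_wt3W_ind_box p D (Set.univ : Set (Finset (Sym2 V))) (tyEv τ s) (tyEv τ t)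
  rw [PrW_univ, one_mul] at hb
  rw [← hb, Finset.mul_sum]
  exact Finset.sum_congr rfl fun x _ => by ring

/-- **`E[λ_p ∘ Φ_p] = Σ λ_p(s,t) P_s P_t`**: the switching of program `q` preserves the triple law. [this work] -/
theorem sum_wt3W_prog (q : Prog) :
    ∑ x ∈ triples D, wt3W D p x * (q.lam (ftype τ (q.out τ x 1)) (ftype τ (q.out τ x 2)) : ℝ) =
      ∑ s, ∑ t, (q.lam s t : ℝ) * (PrW D p (tyEv τ s) * PrW D p (tyEv τ t)) := by
  rw [← sum_wt3W_lam2 τ p D q.lam]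
  match hk : q.kind with
  | 0 => simp only [Prog.out, hk]; exact sum_wt3W_psi1 p D (roots τ q.U) fun y => (q.lam (ftype τ (y 1)) (ftype τ (y 2)) : ℝ)
  | 1 => simp only [Prog.out, hk]; exact sum_wt3W_psi2 p D (roots τ q.U) fun y => (q.lam (ftype τ (y 1)) (ftype τ (y 2)) : ℝ)
  | 2 =>
    simp only [Prog.out, hk]
    exact sum_wt3W_psi3 p D (roots τ q.U) (roots τ {q.v}) fun y => (q.lam (ftype τ (y 1)) (ftype τ (y 2)) : ℝ)
  | 3 =>
    simp only [Prog.out, hk]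
    exact sum_wt3W_psi4 p D (roots τ {q.v}) (roots τ q.U) fun y => (q.lam (ftype τ (y 1)) (ftype τ (y 2)) : ℝ)

/-! ### The expectation of a certificate -/

/-- `Σ_p Σ_{s,t} λ_p(s,t) P_s P_t` over a program list. [this work] -/
def esProgs (P : Ty → ℝ) : List Prog → ℝ
  | [] => 0
  | q :: qs => (∑ s, ∑ t, (q.lam s t : ℝ) * (P s * P t)) + esProgs P qs

/-- **`ES c P`** — the expectation of the certificate as a polynomial in the type masses `P`. [this work] -/
def ES (c : Cert) (P : Ty → ℝ) : ℝ := (∑ r, ∑ s, ∑ t, (c.lam0 r s t : ℝ) * (P r * P s * P t)) + esProgs P c.progs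

/-- The program part of the expectation. [this work] -/
theorem sum_wt3W_sumLam : ∀ qs : List Prog,
    ∑ x ∈ triples D, wt3W D p x * (sumLam τ x qs : ℝ) = esProgs (fun t => PrW D p (tyEv τ t)) qs
  | [] => by simp [sumLam, esProgs]
  | q :: qs => by
    simp only [sumLam, esProgs, Int.cast_add, mul_add, Finset.sum_add_distrib]
    rw [sum_wt3W_prog τ p D q, sum_wt3W_sumLam qs]

/-- **`E[S] = ES c P`** with `P t = PrW D p {type = t}`. [this work] -/
theorem sum_wt3W_Sreal (c : Cert) :
    ∑ x ∈ triples D, wt3W D p x * (Sreal τ c x : ℝ) = ES c fun t => PrW D p (tyEv τ t) := by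
  simp only [Sreal, Int.cast_add, mul_add, Finset.sum_add_distrib, ES]
  rw [sum_wt3W_lam0 τ p D c.lam0, sum_wt3W_sumLam τ p D c.progs]

/-- **A passing check makes the expectation nonpositive.** [this work] -/
theorem ES_nonpos_of_check (c : Cert) (hc : c.check = true) {p : Sym2 V → ℝ} (hp0 : ∀ i, 0 ≤ p i) (hp1 : ∀ i, p i ≤ 1)
    (D : Finset (Sym2 V)) : ES c (fun t => PrW D p (tyEv τ t)) ≤ 0 := by
  rw [← sum_wt3W_Sreal τ p D c]
  exact Finset.sum_nonpos fun x _ =>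
    mul_nonpos_of_nonneg_of_nonpos (DTree3.wt3W_nonneg D hp0 hp1 x) (by exact_mod_cast Cert.sound τ c hc x)

/-! ### Entry lists of potentials (for the algebraic identity of a certificate file) -/

/-- The double sum of an entry-list table is the sum over its entries. [this work] -/
theorem sum2_lookup2 (P : Ty → ℝ) : ∀ l : List (Ty × Ty × ℤ),
    ∑ s, ∑ t, (lookup2 l s t : ℝ) * (P s * P t) = (l.map fun e => (e.2.2 : ℝ) * (P e.1 * P e.2.1)).sum
  | [] => by simp [lookup2]
  | e :: l => by
    have ih := sum2_lookup2 P l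
    simp only [lookup2, List.map_cons, List.sum_cons, Int.cast_add, add_mul, Finset.sum_add_distrib] at ih ⊢
    rw [ih]
    congr 1
    have h : ∀ s t : Ty, ((if e.1 = s ∧ e.2.1 = t then e.2.2 else 0 : ℤ) : ℝ) * (P s * P t) =
        if e.1 = s then (if e.2.1 = t then (e.2.2 : ℝ) * (P e.1 * P e.2.1) else 0) else 0 := by
      intro s t; split_ifs <;> simp_all
    simp only [h, sum_ite₂]

/-- The triple sum of an entry-list table is the sum over its entries. [this work] -/
theorem sum3_lookup3 (P : Ty → ℝ) : ∀ l : List (Ty × Ty × Ty × ℤ),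
    ∑ r, ∑ s, ∑ t, (lookup3 l r s t : ℝ) * (P r * P s * P t) = (l.map fun e => (e.2.2.2 : ℝ) * (P e.1 * P e.2.1 * P e.2.2.1)).sum
  | [] => by simp [lookup3]
  | e :: l => by
    have ih := sum3_lookup3 P l
    simp only [lookup3, List.map_cons, List.sum_cons, Int.cast_add, add_mul, Finset.sum_add_distrib] at ih ⊢
    rw [ih]
    congr 1
    have h : ∀ r s t : Ty, ((if e.1 = r ∧ e.2.1 = s ∧ e.2.2.1 = t then e.2.2.2 else 0 : ℤ) : ℝ) * (P r * P s * P t) =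
        if e.1 = r then (if e.2.1 = s then (if e.2.2.1 = t then (e.2.2.2 : ℝ) * (P e.1 * P e.2.1 * P e.2.2.1) else 0)
          else 0) else 0 := by
      intro r s t; split_ifs <;> simp_all
    simp only [h, sum_ite₃]

/-- Rewriting a potential given as a function through an entry list it agrees with. [this work] -/
theorem sum2_eq_entries {f : Ty → Ty → ℤ} {l : List (Ty × Ty × ℤ)} (h : ∀ s t, f s t = lookup2 l s t) (P : Ty → ℝ) :
    ∑ s, ∑ t, (f s t : ℝ) * (P s * P t) = (l.map fun e => (e.2.2 : ℝ) * (P e.1 * P e.2.1)).sum := by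
  simp only [h]; exact sum2_lookup2 P l

/-- Rewriting an input potential through an entry list it agrees with. [this work] -/
theorem sum3_eq_entries {f : Ty → Ty → Ty → ℤ} {l : List (Ty × Ty × Ty × ℤ)} (h : ∀ r s t, f r s t = lookup3 l r s t)
    (P : Ty → ℝ) :
    ∑ r, ∑ s, ∑ t, (f r s t : ℝ) * (P r * P s * P t) = (l.map fun e => (e.2.2.2 : ℝ) * (P e.1 * P e.2.1 * P e.2.2.1)).sum := by
  simp only [h]; exact sum3_lookup3 P l

/-- Agreement of two tables from a kernel check over `allTys` (avoids `Fintype` decidability in the kernel). [folklore] -/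
theorem forall₂_of_allTys {f g : Ty → Ty → ℤ} (h : (allTys.all fun s => allTys.all fun t => f s t == g s t) = true) :
    ∀ s t, f s t = g s t := by
  intro s t
  have h1 := List.all_eq_true.1 h s (mem_allTys s)
  have h2 := List.all_eq_true.1 h1 t (mem_allTys t)
  exact eq_of_beq h2

/-- Agreement of two triple tables from a kernel check over `allTys`. [folklore] -/
theorem forall₃_of_allTys {f g : Ty → Ty → Ty → ℤ}
    (h : (allTys.all fun r => allTys.all fun s => allTys.all fun t => f r s t == g r s t) = true) :
    ∀ r s t, f r s t = g r s t := by
  intro r s t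
  have h1 := List.all_eq_true.1 h r (mem_allTys r)
  have h2 := List.all_eq_true.1 h1 s (mem_allTys s)
  have h3 := List.all_eq_true.1 h2 t (mem_allTys t)
  exact eq_of_beq h3

end Finitary

/-! ### The bridge to the four-point cells of `prodBernoulli w` (classical instances, as in the measure-level files) -/

section Measure

variable {V : Type*} [Fintype V] (τ : Fin 4 → V)

/-- Every row of `pat4` is a canonical labeling. [folklore] -/
theorem isCanon_pat4 (t : Ty) : IsCanon (pat4 t) :=
  mem_canonSet.1 (by rw [← image_pat4]; exact Finset.mem_image_of_mem _ (Finset.mem_univ t))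

/-- **Types and atoms agree**: `↑K` lies in the connectivity atom of `pat4 t` iff `ftype τ K = t`. [this work] -/
theorem coe_mem_atom_iff (K : Finset (Sym2 V)) (t : Ty) : (↑K : Set (Sym2 V)) ∈ atom τ (pat4 t) ↔ ftype τ K = t := by
  have hK : IsCanon (pat4 (ftype τ K)) := by rw [pat4_ftype]; exact isCanon_canonOf (rel_equivalence τ K)
  have hmean : ∀ i j, pat4 (ftype τ K) i = pat4 (ftype τ K) j ↔ (openGraph (↑K : Set (Sym2 V))).Reachable (τ i) (τ j) :=
    fun i j => by rw [← mem_cl, ← jn_ftype_iff τ K i j, jn, decide_eq_true_iff]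
  rw [mem_atom]
  constructor
  · intro h
    exact pat4_injective (IsCanon.eq_of_forall_iff hK (isCanon_pat4 t) fun i j => (hmean i j).trans (h i j))
  · rintro rfl i j
    exact (hmean i j).symm

/-- At `D = univ` the type masses are the four-point cells of `prodBernoulli w`. [this work] -/
theorem PrW_tyEv_eq_cell (w : Sym2 V → unitInterval) (a b c y : V) (t : Ty) :
    PrW Finset.univ (fun e => (w e : ℝ)) (tyEv (quad a b c y) t) = cell w a b c y t := by
  unfold cell
  symm
  exact prodBernoulli_real_eq_PrW_univ w fun S => (coe_mem_atom_iff (quad a b c y) S t).symm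

end Measure

end SwitchRelax

end Summit.CriticalPhenomena.PercolationContinuityZ3.Theorems

end
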